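import Literature.Geometry.Symplectic.LefschetzBaseModelStein
import HarnessLib

/-!
# A-priori bounds on the boundary of the rounded convex model of the Lefschetz base

Topic `Literature/Geometry/Symplectic`; a proofs-only companion (no definition, no named fact) of
`LefschetzBaseModelStein.lean` feeding the transversality estimate `dθ(R) > 0` of the Reeb
criterion for the handle-free base case of `palf_stein_supportedByBoundaryOpenBook`
(`LefschetzBaseModelReebFormula.lean` and its sequel).  On the level
`{Ψ = 1/4}`, `Ψ = modelFun g ε (qPert δ) = ‖w‖² + Θ(‖x‖²) + ε(‖x‖² + δ m(‖y‖²))`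
(`0 ≤ ε ≤ 1/40`, `0 ≤ δ ≤ 1`), writing `s = ‖x‖²`, `t = ‖y‖²`:

* `norm_w_sq_le_of_level` — `‖w‖² ≤ 1/4`;
* in the region `t < 3/10` (the only one where the cut-off `m` is active):
  `norm_sq_cx_lt_four_of_level` (`s < 4`), `convexProfile_derivs_eq_zero` (`Θ = Θ' = Θ'' = 0`),
  `norm_w_ge_of_level` (`‖w‖ ≥ 3/10`), `norm_cx_pow_ge_of_level` (`‖x‖^{2g+1} ≥ 1/5`),
  `norm_dP_ge_of_level` (`‖p'(x)‖ ≥ 1/10`);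
* `yMass_le`, `exists_bound_deriv_yMass` (`0 ≤ m(t) ≤ t` for `t ≥ 0`, `|m'| ≤ C'` on `t ≥ 0`),
  `deriv_yMass_of_ge`, `yMassLevi_of_ge` (`m' = μ = 0` for `t ≥ 3/10`, by continuity at
  `t = 3/10`), `deriv_deriv_eq_zero_of_lt_four` (`Θ'' = 0` on `s < 4`).

## References

* J. B. Etnyre, *Lectures on open book decompositions and contact structures*, Clay Math.
  Proc. 5 (2006), Lemma 3.3. [Etnyre2006]
-/

noncomputable section

open scoped Manifold ContDiff Topology ComplexConjugate
open Set Function Complex Filter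

namespace Literature.Geometry.Symplectic

open Literature.Topology.FourManifolds Literature.Topology.FourManifolds.LefschetzBase
  LefschetzBaseSteinModel

/-! ### The cut-off `m` and the profile `Θ`: complements -/

/-- `0 ≤ m(t) ≤ t` for `t ≥ 0`. [folklore] -/
theorem yMass_le {t : ℝ} (ht : 0 ≤ t) : yMass t ≤ t := by
  rw [yMass]
  have h1 : yCutoff t ≤ 1 := Real.smoothTransition.le_one _
  nlinarith [yCutoff_nonneg t]

/-- `m' = 0` for `t ≥ 3/10` (at `t = 3/10` by continuity of `m'`). [folklore] -/
theorem deriv_yMass_of_ge {t : ℝ} (ht : 3 / 10 ≤ t) : deriv yMass t = 0 := by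
  rcases lt_or_eq_of_le ht with h | h
  · exact deriv_yMass_of_gt h
  · -- continuity at the endpoint
    have hc : Continuous (deriv yMass) := (contDiff_yMass.iterate_deriv 1).continuous
    have hcl : IsClosed {u : ℝ | deriv yMass u = 0} := isClosed_eq hc continuous_const
    have hsub : Ioi (3 / 10 : ℝ) ⊆ {u : ℝ | deriv yMass u = 0} := fun u hu => deriv_yMass_of_gt hu
    have hmem : t ∈ closure (Ioi (3 / 10 : ℝ)) := by
      rw [closure_Ioi, ← h]; exact self_mem_Ici
    exact hcl.closure_subset_iff.2 hsub hmem

/-- `m'' = 0` for `t ≥ 3/10`. [folklore] -/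
theorem deriv_deriv_yMass_of_ge {t : ℝ} (ht : 3 / 10 ≤ t) : deriv (deriv yMass) t = 0 := by
  rcases lt_or_eq_of_le ht with h | h
  · exact deriv_deriv_yMass_of_gt h
  · have hc : Continuous (deriv (deriv yMass)) := (contDiff_yMass.iterate_deriv 2).continuous
    have hcl : IsClosed {u : ℝ | deriv (deriv yMass) u = 0} := isClosed_eq hc continuous_const
    have hsub : Ioi (3 / 10 : ℝ) ⊆ {u : ℝ | deriv (deriv yMass) u = 0} :=
      fun u hu => deriv_deriv_yMass_of_gt hu
    have hmem : t ∈ closure (Ioi (3 / 10 : ℝ)) := by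
      rw [closure_Ioi, ← h]; exact self_mem_Ici
    exact hcl.closure_subset_iff.2 hsub hmem

/-- `μ = 0` for `t ≥ 3/10`. [folklore] -/
theorem yMassLevi_of_ge {t : ℝ} (ht : 3 / 10 ≤ t) : yMassLevi t = 0 := by
  rw [yMassLevi, deriv_yMass_of_ge ht, deriv_deriv_yMass_of_ge ht, mul_zero, add_zero]

/-- `m'` is bounded on `t ≥ 0`. [folklore] -/
theorem exists_bound_deriv_yMass : ∃ C : ℝ, 0 ≤ C ∧ ∀ t : ℝ, 0 ≤ t → |deriv yMass t| ≤ C := by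
  have hc : Continuous (deriv yMass) := (contDiff_yMass.iterate_deriv 1).continuous
  obtain ⟨C, hC⟩ := (isCompact_Icc : IsCompact (Icc (0 : ℝ) (3 / 10))).exists_bound_of_continuousOn
    hc.continuousOn
  refine ⟨max C 0, le_max_right _ _, fun t ht => ?_⟩
  rcases le_or_gt t (3 / 10) with h | h
  · have := hC t ⟨ht, h⟩
    rw [Real.norm_eq_abs] at this
    exact this.trans (le_max_left _ _)
  · rw [deriv_yMass_of_gt h, abs_zero]
    exact le_max_right _ _

/-- `Θ'' = 0` on `s < 4` (`Θ' = 0` on the open set `s < 4`). [folklore] -/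
theorem deriv_deriv_convexProfile_eq_zero_of_lt {s : ℝ} (hs : s < 4) :
    deriv (deriv convexProfile) s = 0 := by
  have hev : deriv convexProfile =ᶠ[𝓝 s] fun _ => (0 : ℝ) := by
    filter_upwards [gt_mem_nhds hs] with u hu
    exact deriv_eq_zero_of_lt_four (fun _ hs => convexProfile_of_le_four hs) hu
  rw [hev.deriv_eq, deriv_const]

/-- `Θ' = 0` on `s < 4`. [folklore] -/
theorem deriv_convexProfile_eq_zero_of_lt {s : ℝ} (hs : s < 4) : deriv convexProfile s = 0 :=
  deriv_eq_zero_of_lt_four (fun _ hs' => convexProfile_of_le_four hs') hs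

/-! ### Bounds on the level `{Ψ = 1/4}` -/

section Level

variable {g : ℕ} {ε δ : ℝ} {z : EuclideanSpace ℝ (Fin 4)}

/-- `‖w‖² ≤ 1/4` on `{Ψ ≤ 1/4}` (`ε, δ ≥ 0`). [folklore] -/
theorem norm_w_sq_le_of_level (hε : 0 ≤ ε) (hδ : 0 ≤ δ) (hz : modelFun g ε (qPert δ) z ≤ 1 / 4) :
    ‖w g z‖ ^ 2 ≤ 1 / 4 := by
  have h1 := (bounds_of_rho_le g ((rho_le_modelFun g hε (qPert_nonneg hδ) z).trans hz)).2
  exact h1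

/-- `rho ≤ 1/4` on `{Ψ ≤ 1/4}`. [folklore] -/
theorem rho_le_of_level (hε : 0 ≤ ε) (hδ : 0 ≤ δ) (hz : modelFun g ε (qPert δ) z ≤ 1 / 4) :
    rho g z ≤ 1 / 4 :=
  (rho_le_modelFun g hε (qPert_nonneg hδ) z).trans hz

/-- In the cut-off region `t < 3/10` of `{Ψ ≤ 1/4}`: `s < 4`. [folklore] -/
theorem norm_sq_cx_lt_four_of_level (hε : 0 ≤ ε) (hδ : 0 ≤ δ)
    (hz : modelFun g ε (qPert δ) z ≤ 1 / 4) (ht : ‖cy z‖ ^ 2 < 3 / 10) : ‖cx z‖ ^ 2 < 4 :=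
  norm_sq_cx_lt_four_of_norm_sq_cy_lt g (norm_w_sq_le_of_level hε hδ hz) ht

/-- In the cut-off region of the level: `‖w‖² ≥ 1/4 - ε (4 + 3/10)`, hence `‖w‖ ≥ 3/10` for
`ε ≤ 1/40`, `δ ≤ 1`. [folklore] -/
theorem norm_w_ge_of_level (hε : 0 ≤ ε) (hε' : ε ≤ 1 / 40) (hδ : 0 ≤ δ) (hδ' : δ ≤ 1)
    (hz : modelFun g ε (qPert δ) z = 1 / 4) (ht : ‖cy z‖ ^ 2 < 3 / 10) : 3 / 10 ≤ ‖w g z‖ := by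
  have hs : ‖cx z‖ ^ 2 < 4 := norm_sq_cx_lt_four_of_level hε hδ hz.le ht
  have hΘ : convexProfile (‖cx z‖ ^ 2) = 0 := convexProfile_of_le_four hs.le
  have hm : yMass (‖cy z‖ ^ 2) ≤ ‖cy z‖ ^ 2 := yMass_le (sq_nonneg _)
  have hm0 : 0 ≤ yMass (‖cy z‖ ^ 2) := yMass_nonneg (sq_nonneg _)
  rw [modelFun_apply, qPert_apply, hΘ] at hz
  have h1 : δ * yMass (‖cy z‖ ^ 2) ≤ 3 / 10 := by nlinarith
  have h2 : ε * (‖cx z‖ ^ 2 + δ * yMass (‖cy z‖ ^ 2)) ≤ 1 / 40 * (4 + 3 / 10) := by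
    apply mul_le_mul hε' _ (by nlinarith) (by norm_num)
    linarith
  have hw2 : 9 / 100 ≤ ‖w g z‖ ^ 2 := by nlinarith
  nlinarith [norm_nonneg (w g z)]

/-- In the cut-off region of the level: `‖x‖^{2g+1} ≥ 1/5` (`x^{2g+1} = y² - w - 1`,
`‖y‖² < 3/10`, `‖w‖ ≤ 1/2`). [folklore] -/
theorem norm_cx_pow_ge_of_level (hε : 0 ≤ ε) (hδ : 0 ≤ δ)
    (hz : modelFun g ε (qPert δ) z ≤ 1 / 4) (ht : ‖cy z‖ ^ 2 < 3 / 10) :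
    1 / 5 ≤ ‖cx z‖ ^ (2 * g + 1) := by
  have hw2 := norm_w_sq_le_of_level hε hδ hz
  have hw : ‖w g z‖ ≤ 1 / 2 := by nlinarith [norm_nonneg (w g z)]
  have hx : cx z ^ (2 * g + 1) = cy z ^ 2 - w g z - 1 := by
    rw [cy_sq_eq g z]; ring
  have h1 : ‖cx z‖ ^ (2 * g + 1) = ‖cy z ^ 2 - w g z - 1‖ := by rw [← norm_pow, hx]
  have h2 : (1 : ℝ) - ‖cy z ^ 2‖ - ‖w g z‖ ≤ ‖cy z ^ 2 - w g z - 1‖ := by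
    have := norm_sub_norm_le (1 : ℂ) (cy z ^ 2 - w g z)
    have h3 : ‖cy z ^ 2 - w g z‖ ≤ ‖cy z ^ 2‖ + ‖w g z‖ := norm_sub_le _ _
    have h4 : ‖(1 : ℂ) - (cy z ^ 2 - w g z)‖ = ‖cy z ^ 2 - w g z - 1‖ := by
      rw [← norm_neg]; congr 1; ring
    rw [norm_one, h4] at this
    linarith
  rw [norm_pow] at h2
  linarith

/-- In the cut-off region of the level: `‖p'(x)‖ = (2g+1)‖x‖^{2g} ≥ 1/10`. [folklore] -/
theorem norm_dP_ge_of_level (hε : 0 ≤ ε) (hδ : 0 ≤ δ)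
    (hz : modelFun g ε (qPert δ) z ≤ 1 / 4) (ht : ‖cy z‖ ^ 2 < 3 / 10) :
    1 / 10 ≤ ‖dP g (cx z)‖ := by
  have hp := norm_cx_pow_ge_of_level hε hδ hz ht
  have hs : ‖cx z‖ ^ 2 < 4 := norm_sq_cx_lt_four_of_level hε hδ hz ht
  have hx2 : ‖cx z‖ < 2 := by nlinarith [norm_nonneg (cx z)]
  have hx0 : 0 ≤ ‖cx z‖ := norm_nonneg _
  -- `‖x‖^{2g} ≥ 1/10`
  have hpow : 1 / 10 ≤ ‖cx z‖ ^ (2 * g) := by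
    by_contra hcon
    rw [not_le] at hcon
    have : ‖cx z‖ ^ (2 * g + 1) < 1 / 10 * 2 := by
      rw [pow_succ]
      exact mul_lt_mul'' hcon hx2 (pow_nonneg hx0 _) hx0
    linarith
  have hdP : ‖dP g (cx z)‖ = (2 * g + 1 : ℕ) * ‖cx z‖ ^ (2 * g) := by
    rw [dP, norm_mul, norm_pow, Complex.norm_natCast]
  rw [hdP]
  have hg : (1 : ℝ) ≤ (2 * g + 1 : ℕ) := by exact_mod_cast Nat.succ_le_succ (Nat.zero_le _)
  nlinarith

/-- On the level: `‖x‖² < 6`, so `‖x‖ ≤ 3`. [folklore] -/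
theorem norm_cx_le_three_of_level (hε : 0 ≤ ε) (hδ : 0 ≤ δ)
    (hz : modelFun g ε (qPert δ) z ≤ 1 / 4) : ‖cx z‖ ≤ 3 := by
  have h := (bounds_of_rho_le g (rho_le_of_level hε hδ hz)).1
  nlinarith [norm_nonneg (cx z)]

end Level

end Literature.Geometry.Symplectic

end
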